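import Mathlib
import Summits.AtomisticToContinuum.FouriersLaw.Theses.EmbeddedDrudeMourre
import Summits.AtomisticToContinuum.FouriersLaw.Theorems.EmbeddedDrudeMourreDrudeDissolutionStubExcursionSecondDifferenceSheetFnSublevel
import Summits.AtomisticToContinuum.FouriersLaw.Theorems.EmbeddedDrudeMourreDrudeDissolutionStubExcursionSecondDifferenceTubeDiag
import HarnessLib

/-!
# Geometry of the free pair resonance for stub B1b″ of line `kinetic-polymer-gas-on-the-time-axis`:
# the volume of the tube around a co-moving curve (abstract transversal coordinate)
(crux `EmbeddedDrudeMourre.DrudeDissolution`, item stmt-AtomisticToContinuum-12593; `--supports` file, closes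
nothing; lead c13, geometry input (G-T6b/c) of the B1b″ discard bound)

WHAT. `cellMeasure_tube_comoving_le`: on the cell `(−π,π]³` read at `p = (k₁,(k₃,k₂))`, for ANY function
`A : ℝ³ → ℝ` which is `2π`-periodic in absolute value in the middle slot, `L`-Lipschitz in the middle slot on the box
`[−π,π] × [−3π,3π] × [−π,π]`, and dominates the plane restriction of the resonant sheet on the exchange plane,
`|H₀(k₁,k₂)| ≤ M·|A(k₁,k₁,k₂)|`, the tube `{S₁² + A² < η²}` (`S₁ = sin((k₃−k₁)/2)`) has cell measure `≤ Cη²` for all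
`η > 0`. The twin seat instantiates `A = 8H/((Σω)(ω₁ω₂+ω₃ω₄))` (`Ω = −A·S₁·S₂`, `stub_resonanceFactorisation`), whose
plane value is `2H₀/((ω₁+ω₂)ω₁ω₂)`; the tube around the second co-moving curve `{S₂² + A² < η²}` follows by the
`k₁ ↔ k₂` symmetry of `A` and of the cell measure.

HOW. On the tube, `|S₁| < η` puts `k₃` within `πη` of `k₁ + 2πm`, `m ∈ {−1,0,1}` (`abs_sin_half_lt_windows`);
periodicity and the Lipschitz bound move `A` to the plane: `|A(k₁,k₁,k₂)| < (1 + Lπ)η`, so `|H₀(k₁,k₂)| < M(1+Lπ)η`;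
two Tonelli slices then bound the measure by `4πη · Area{|H₀| < M(1+Lπ)η} ≤ 4πη · C′M(1+Lπ)η`
(`volume_cell_abs_sin_half_lt_le`, `area_sublevel_sheetFn_plane_le`).
-/

noncomputable section

open Set Real Topology MeasureTheory
open scoped ENNReal
open Literature.MathematicalPhysics.KineticTheory
open Literature.MathematicalPhysics.KineticTheory.PhononBoltzmann

namespace Summit.AtomisticToContinuum.FouriersLaw.Theorems.DrudeDissolution.KineticPolymerGasOnTheTimeAxis

/-- **Registered sub-goal `cellMeasure_tube_comoving_le` (G-T6b/c, abstract transversal coordinate): the tube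
around a co-moving curve is `O(η²)`.** For `ω₂ > 0`, `L, M ≥ 0` and `A : ℝ × ℝ × ℝ → ℝ` with
`|A(k₁, k₃ + 2π, k₂)| = |A(k₁,k₃,k₂)|`, `|A(k₁,x,k₂) − A(k₁,y,k₂)| ≤ L|x − y|` for `k₁, k₂ ∈ [−π,π]`, `x, y ∈ [−3π,3π]`,
and `|2(ω(k₁)ω(k₂)+ω₂+2)cos((k₁+k₂)/2) − 4cos((k₁−k₂)/2)| ≤ M|A(k₁,k₁,k₂)|`: there is `C` such that for all `η > 0`
`μ_cell {p : sin²((p.2.1−p.1)/2) + (A p)² < η²} ≤ C η²`. [folklore] -/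
theorem cellMeasure_tube_comoving_le :
    ∀ ω₂ : ℝ, 0 < ω₂ → ∀ (A : ℝ × ℝ × ℝ → ℝ) (L M : ℝ), 0 ≤ L → 0 ≤ M →
      (∀ k₁ k₃ k₂ : ℝ, |A (k₁, k₃ + 2 * Real.pi, k₂)| = |A (k₁, k₃, k₂)|) →
      (∀ k₁ k₂ x y : ℝ, k₁ ∈ Icc (-Real.pi) Real.pi → k₂ ∈ Icc (-Real.pi) Real.pi →
        x ∈ Icc (-(3 * Real.pi)) (3 * Real.pi) → y ∈ Icc (-(3 * Real.pi)) (3 * Real.pi) →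
        |A (k₁, x, k₂) - A (k₁, y, k₂)| ≤ L * |x - y|) →
      (∀ k₁ k₂ : ℝ, |2 * (dispersion ω₂ k₁ * dispersion ω₂ k₂ + ω₂ + 2) * Real.cos ((k₁ + k₂) / 2) -
          4 * Real.cos ((k₁ - k₂) / 2)| ≤ M * |A (k₁, k₁, k₂)|) →
      ∃ C : ℝ, ∀ η : ℝ, 0 < η →
        ((volume.restrict (Set.Ioc (-Real.pi) Real.pi)).prod
            ((volume.restrict (Set.Ioc (-Real.pi) Real.pi)).prod (volume.restrict (Set.Ioc (-Real.pi) Real.pi))))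
          {p : ℝ × ℝ × ℝ | Real.sin ((p.2.1 - p.1) / 2) ^ 2 + A p ^ 2 < η ^ 2} ≤ ENNReal.ofReal (C * η ^ 2) := by
  intro ω₂ hω A L M hL hM hper hlip hdom
  have hπ := Real.pi_pos
  obtain ⟨C', hC'⟩ := area_sublevel_sheetFn_plane_le ω₂ hω
  -- the area constant is non-negative where it matters; use `max C' 0`
  set M' : ℝ := M * (1 + L * Real.pi) + 1 with hM'
  have hM'pos : 0 < M' := by rw [hM']; positivity
  refine ⟨4 * Real.pi * (max C' 0 * M'), fun η hη => ?_⟩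
  set μ₁ : Measure ℝ := volume.restrict (Set.Ioc (-Real.pi) Real.pi) with hμ₁
  -- the product-shaped superset
  set T : Set (ℝ × ℝ × ℝ) := {p | |Real.sin ((p.2.1 - p.1) / 2)| < η ∧
      |2 * (dispersion ω₂ p.1 * dispersion ω₂ p.2.2 + ω₂ + 2) * Real.cos ((p.1 + p.2.2) / 2) -
        4 * Real.cos ((p.1 - p.2.2) / 2)| < M' * η} with hT
  -- Step 1: the tube inside the cell lies in `T`
  have hsub : {p : ℝ × ℝ × ℝ | Real.sin ((p.2.1 - p.1) / 2) ^ 2 + A p ^ 2 < η ^ 2} ∩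
      (Ioc (-Real.pi) Real.pi ×ˢ (Ioc (-Real.pi) Real.pi ×ˢ Ioc (-Real.pi) Real.pi)) ⊆ T := by
    rintro ⟨k₁, k₃, k₂⟩ ⟨hp, hk₁, hk₃, hk₂⟩
    simp only [mem_setOf_eq] at hp ⊢
    have hS : |Real.sin ((k₃ - k₁) / 2)| < η := by
      have h : Real.sin ((k₃ - k₁) / 2) ^ 2 < η ^ 2 := by nlinarith [sq_nonneg (A (k₁, k₃, k₂))]
      exact abs_lt_of_sq_lt_sq' h hη.le |>.elim (fun h1 h2 => abs_lt.2 ⟨h1, h2⟩)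
    have hAη : |A (k₁, k₃, k₂)| < η := by
      have h : A (k₁, k₃, k₂) ^ 2 < η ^ 2 := by nlinarith [sq_nonneg (Real.sin ((k₃ - k₁) / 2))]
      exact abs_lt_of_sq_lt_sq' h hη.le |>.elim (fun h1 h2 => abs_lt.2 ⟨h1, h2⟩)
    refine ⟨hS, ?_⟩
    -- move `k₃` next to `k₁`
    have hu : |k₃ - k₁| < 2 * Real.pi := by
      rw [abs_lt]; constructor <;> linarith [hk₁.1, hk₁.2, hk₃.1, hk₃.2]
    obtain ⟨hu1, hu2⟩ := abs_lt.1 hu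
    obtain ⟨y, hyI, hyA, hyk⟩ : ∃ y : ℝ, y ∈ Icc (-(3 * Real.pi)) (3 * Real.pi) ∧
        |A (k₁, y, k₂)| = |A (k₁, k₃, k₂)| ∧ |k₁ - y| < Real.pi * η := by
      rcases abs_sin_half_lt_windows hu hS with h | h | h
      · refine ⟨k₃, ⟨by linarith [hk₃.1], by linarith [hk₃.2]⟩, rfl, ?_⟩
        rwa [abs_sub_comm]
      · refine ⟨k₃ - 2 * Real.pi, ⟨by linarith [hk₃.1], by linarith [hk₃.2]⟩, ?_, ?_⟩
        · have := hper k₁ (k₃ - 2 * Real.pi) k₂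
          rw [sub_add_cancel] at this
          exact this.symm
        · rw [abs_lt]; constructor <;> linarith [hk₁.2, hk₃.2, hu1, hu2]
      · refine ⟨k₃ + 2 * Real.pi, ⟨by linarith [hk₃.1], by linarith [hk₃.2]⟩, ?_, ?_⟩
        · exact hper k₁ k₃ k₂
        · rw [abs_lt]; constructor <;> linarith [hk₁.1, hk₃.1, hu1, hu2]
    have hk₁' : k₁ ∈ Icc (-Real.pi) Real.pi := Ioc_subset_Icc_self hk₁
    have hk₂' : k₂ ∈ Icc (-Real.pi) Real.pi := Ioc_subset_Icc_self hk₂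
    have hL' := hlip k₁ k₂ k₁ y hk₁' hk₂' ⟨by linarith [hk₁'.1], by linarith [hk₁'.2]⟩ hyI
    have hA0 : |A (k₁, k₁, k₂)| < (1 + L * Real.pi) * η := by
      calc |A (k₁, k₁, k₂)| ≤ |A (k₁, k₁, k₂) - A (k₁, y, k₂)| + |A (k₁, y, k₂)| := by
            have := abs_add_le (A (k₁, k₁, k₂) - A (k₁, y, k₂)) (A (k₁, y, k₂))
            rwa [sub_add_cancel] at this
        _ < L * (Real.pi * η) + η := by
            have h1 : |A (k₁, k₁, k₂) - A (k₁, y, k₂)| ≤ L * (Real.pi * η) :=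
              hL'.trans (mul_le_mul_of_nonneg_left hyk.le hL)
            rw [hyA] at *
            linarith
        _ = (1 + L * Real.pi) * η := by ring
    calc |2 * (dispersion ω₂ k₁ * dispersion ω₂ k₂ + ω₂ + 2) * Real.cos ((k₁ + k₂) / 2) - 4 * Real.cos ((k₁ - k₂) / 2)|
        ≤ M * |A (k₁, k₁, k₂)| := hdom k₁ k₂
      _ ≤ M * ((1 + L * Real.pi) * η) := mul_le_mul_of_nonneg_left hA0.le hM
      _ < M' * η := by rw [hM']; nlinarith
  -- Step 2: measurability of `T`
  have hd : Continuous (dispersion ω₂) :=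
    continuous_iff_continuousAt.2 fun k => (hasDerivAt_dispersion hω k).continuousAt
  have cH : Continuous fun p : ℝ × ℝ × ℝ => |2 * (dispersion ω₂ p.1 * dispersion ω₂ p.2.2 + ω₂ + 2) *
      Real.cos ((p.1 + p.2.2) / 2) - 4 * Real.cos ((p.1 - p.2.2) / 2)| := by
    have c1 : Continuous fun p : ℝ × ℝ × ℝ => dispersion ω₂ p.1 := hd.comp continuous_fst
    have c2 : Continuous fun p : ℝ × ℝ × ℝ => dispersion ω₂ p.2.2 := hd.comp (continuous_snd.comp continuous_snd)
    exact (((continuous_const.mul (((c1.mul c2).add continuous_const).add continuous_const)).mul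
      (by fun_prop)).sub (by fun_prop : Continuous fun p : ℝ × ℝ × ℝ => 4 * Real.cos ((p.1 - p.2.2) / 2))).abs
  have cS : Continuous fun p : ℝ × ℝ × ℝ => |Real.sin ((p.2.1 - p.1) / 2)| := by fun_prop
  have hTm : MeasurableSet T := by
    rw [hT]
    exact (measurableSet_lt cS.measurable measurable_const).inter (measurableSet_lt cH.measurable measurable_const)
  -- Step 3: the measure of `T` by two Tonelli slices
  have hcell : (μ₁.prod (μ₁.prod μ₁)) {p : ℝ × ℝ × ℝ | Real.sin ((p.2.1 - p.1) / 2) ^ 2 + A p ^ 2 < η ^ 2} ≤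
      (μ₁.prod (μ₁.prod μ₁)) T := by
    have e : μ₁.prod (μ₁.prod μ₁) = (volume.prod (volume.prod volume)).restrict
        (Ioc (-Real.pi) Real.pi ×ˢ (Ioc (-Real.pi) Real.pi ×ˢ Ioc (-Real.pi) Real.pi)) := by
      rw [hμ₁, Measure.prod_restrict, Measure.prod_restrict]
    calc (μ₁.prod (μ₁.prod μ₁)) {p : ℝ × ℝ × ℝ | Real.sin ((p.2.1 - p.1) / 2) ^ 2 + A p ^ 2 < η ^ 2}
        = (μ₁.prod (μ₁.prod μ₁)) ({p : ℝ × ℝ × ℝ | Real.sin ((p.2.1 - p.1) / 2) ^ 2 + A p ^ 2 < η ^ 2} ∩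
            (Ioc (-Real.pi) Real.pi ×ˢ (Ioc (-Real.pi) Real.pi ×ˢ Ioc (-Real.pi) Real.pi))) := by
          rw [e, Measure.restrict_apply' (measurableSet_Ioc.prod (measurableSet_Ioc.prod measurableSet_Ioc)),
            Measure.restrict_apply' (measurableSet_Ioc.prod (measurableSet_Ioc.prod measurableSet_Ioc)),
            Set.inter_assoc, Set.inter_self]
      _ ≤ (μ₁.prod (μ₁.prod μ₁)) T := measure_mono hsub
  refine hcell.trans ?_
  rw [Measure.prod_apply hTm]
  -- the slice at `k₁`: a product set in `(k₃, k₂)`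
  have hslice : ∀ k₁ : ℝ, k₁ ∈ Ioc (-Real.pi) Real.pi →
      (μ₁.prod μ₁) (Prod.mk k₁ ⁻¹' T) ≤ ENNReal.ofReal (4 * Real.pi * η) *
        μ₁ {k₂ : ℝ | |2 * (dispersion ω₂ k₁ * dispersion ω₂ k₂ + ω₂ + 2) * Real.cos ((k₁ + k₂) / 2) -
          4 * Real.cos ((k₁ - k₂) / 2)| < M' * η} := by
    intro k₁ hk₁
    have hpre : Prod.mk k₁ ⁻¹' T = {k₃ : ℝ | |Real.sin ((k₃ - k₁) / 2)| < η} ×ˢ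
        {k₂ : ℝ | |2 * (dispersion ω₂ k₁ * dispersion ω₂ k₂ + ω₂ + 2) * Real.cos ((k₁ + k₂) / 2) -
          4 * Real.cos ((k₁ - k₂) / 2)| < M' * η} := by
      ext q; simp [hT]
    rw [hpre, Measure.prod_prod]
    gcongr
    exact volume_cell_abs_sin_half_lt_le hk₁ hη
  have hm2 : Measurable fun q : ℝ × ℝ => |2 * (dispersion ω₂ q.1 * dispersion ω₂ q.2 + ω₂ + 2) *
      Real.cos ((q.1 + q.2) / 2) - 4 * Real.cos ((q.1 - q.2) / 2)| := by
    have c1 : Continuous fun q : ℝ × ℝ => dispersion ω₂ q.1 := hd.comp continuous_fst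
    have c2 : Continuous fun q : ℝ × ℝ => dispersion ω₂ q.2 := hd.comp continuous_snd
    exact (((continuous_const.mul (((c1.mul c2).add continuous_const).add continuous_const)).mul
      (by fun_prop)).sub (by fun_prop : Continuous fun q : ℝ × ℝ => 4 * Real.cos ((q.1 - q.2) / 2))).abs.measurable
  have hQm : MeasurableSet {q : ℝ × ℝ | |2 * (dispersion ω₂ q.1 * dispersion ω₂ q.2 + ω₂ + 2) *
      Real.cos ((q.1 + q.2) / 2) - 4 * Real.cos ((q.1 - q.2) / 2)| < M' * η} :=
    measurableSet_lt hm2 measurable_const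
  calc ∫⁻ k₁, (μ₁.prod μ₁) (Prod.mk k₁ ⁻¹' T) ∂μ₁
      ≤ ∫⁻ k₁, ENNReal.ofReal (4 * Real.pi * η) *
          μ₁ {k₂ : ℝ | |2 * (dispersion ω₂ k₁ * dispersion ω₂ k₂ + ω₂ + 2) * Real.cos ((k₁ + k₂) / 2) -
            4 * Real.cos ((k₁ - k₂) / 2)| < M' * η} ∂μ₁ := by
        rw [hμ₁]
        exact setLIntegral_mono' measurableSet_Ioc fun k₁ hk₁ => hslice k₁ hk₁
    _ = ENNReal.ofReal (4 * Real.pi * η) *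
          ∫⁻ k₁, μ₁ {k₂ : ℝ | |2 * (dispersion ω₂ k₁ * dispersion ω₂ k₂ + ω₂ + 2) * Real.cos ((k₁ + k₂) / 2) -
            4 * Real.cos ((k₁ - k₂) / 2)| < M' * η} ∂μ₁ := by
        rw [lintegral_const_mul']
        exact ENNReal.ofReal_ne_top
    _ = ENNReal.ofReal (4 * Real.pi * η) * (μ₁.prod μ₁)
          {q : ℝ × ℝ | |2 * (dispersion ω₂ q.1 * dispersion ω₂ q.2 + ω₂ + 2) * Real.cos ((q.1 + q.2) / 2) -
            4 * Real.cos ((q.1 - q.2) / 2)| < M' * η} := by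
        rw [Measure.prod_apply hQm]
        rfl
    _ ≤ ENNReal.ofReal (4 * Real.pi * η) * ENNReal.ofReal (max C' 0 * (M' * η)) := by
        gcongr
        refine (hC' (M' * η) (by positivity)).trans (ENNReal.ofReal_le_ofReal ?_)
        exact mul_le_mul_of_nonneg_right (le_max_left _ _) (by positivity)
    _ = ENNReal.ofReal (4 * Real.pi * (max C' 0 * M') * η ^ 2) := by
        rw [← ENNReal.ofReal_mul (by positivity)]
        congr 1; ring

end Summit.AtomisticToContinuum.FouriersLaw.Theorems.DrudeDissolution.KineticPolymerGasOnTheTimeAxis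

end
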